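import Literature.MathematicalPhysics.QuantumFieldTheory.ElectricFluxPositivity
import HarnessLib

/-!
# Axis-reversal covariance of 't Hooft's twisted partition functions and the reality of the
# electric-flux weights (5.4)

Topic `Literature/MathematicalPhysics/QuantumFieldTheory`; theorem-only sequel of `TwistSectorOperations.lean`
(`MultiTwist.invertDir μ z`: the twist with the planes through the axis `μ` inverted — the twist read in the
coordinates with `x_μ ↦ -x_μ`), `CentralInsertionSiteRP.lean` (`InsertionSiteRP.reflectInsertion`, the
reflection law `plaqReIns_negReflect`), `TwistedPartitionFunctionMonotone.lean` (temporal stacks, transposition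
covariance `twistZ_transposeTwist`) and `ElectricFluxPositivity.lean` ('t Hooft's (5.4)).

## What is proved (everything; no facts, no definitions)

G. 't Hooft, Nucl. Phys. B153 (1979) 141 [tHooft1979Flux], §6 first sentence (reprint p. 553): «Clearly, W
will be invariant under joint rotations of `a_μ` and `n_{μν}` in Euclidean space» — on the SYMMETRIC lattice
torus `(ℤ/Lℤ)^d` (all `a_μ` equal) the lattice symmetry group fixing the origin is generated by the axis
transpositions (`twistZ_transposeTwist`, already in the tree) and the axis REVERSALS `x_μ ↦ -x_μ`, which act
on the twist by inverting the planes through `μ`: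

* `InsertionSiteRP.insertedWilsonAction_negReflect`, ★ `insertedPartitionFunction_reflectInsertion`: the
  change of variables `U ↦ Θ'U` (`GaugeConfig.negReflect`, Haar-measure preserving) transports the action
  with a central insertion `u` into the action with the reflected insertion `uᶿ`, so `Z_{uᶿ} = Z_u`
  (Kanazawa 2009 Lemma 2 eq. (15) `θ[𝒪^{[k]}[𝒱]] = 𝒪^{[-k]}[𝒱^θ]`, integrated);
* ★★ `MultiTwist.twistZ_invertDir_zero`, `twistZ_invertDir`: `Z(invertDir μ z) = Z(z)` for every twist `z`,
  every axis `μ`, any compact `G`, continuous `ρ`, real `β`, `L ≥ 2` — for `μ = 0` this is 't Hooft's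
  `W{k, m} = W{-k, m}`;
* `MultiTwist.invertDir_twistOfTensor`, `sun_twistZ_invertDir`: the `SU(N)` tensor form (the components
  `n_{μν}`, `μ` or `ν` the reversed axis, change sign);
* ★★ `MultiTwist.sun_twistZ_temporal_neg` (`W{m + temporalTensor (-k)} = W{m + temporalTensor k}`, magnetic
  `m`) and `electricFluxWeight_im_eq_zero`, `conj_electricFluxWeight`: 't Hooft's electric-flux weight (5.4)
  `e^{-βF(e,m)} = (1/N^n) Σ_k e^{-2πi(k·e)/N} W{m+k}` is REAL for every `β`, every `L ≥ 2`, every `e` and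
  every purely magnetic `m` — by the `k ↦ -k` symmetry (the docstring of `THooftFlux.electricFluxWeight`:
  «real by `k ↦ -k` symmetry when `W{m+k} = W{m-k}`»), independently of the reflection-positivity proof
  `electricFluxWeight_re_nonneg` (which needs `L` even and gives the sign as well).

Scope / HONEST FRAMING: finite symmetric torus; (6.2) itself (the specific `SO(4)` rotation (6.1) mixing
`(k̃, m̃)`, written by 't Hooft for a general box `a_μ`) and the duality equation (6.3) are NOT asserted here —
only the generators of the lattice symmetry group of the symmetric torus acting on `W`.

## References
* G. 't Hooft, Nucl. Phys. B153 (1979) 141–160, §5 eq. (5.4), §6 first sentence and eqs. (6.1)–(6.2)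
  (reprint: C. Rebbi (ed.), *Lattice Gauge Theories and Monte Carlo Simulations*, pp. 552–554). [tHooft1979Flux]
* T. Kanazawa, Ann. Phys. 324 (2009) 1634–1665, §2 Lemma 1 eq. (11), Lemma 2 eq. (15). [Kanazawa2008]
-/

open MeasureTheory Finset Complex
open scoped ComplexConjugate BigOperators

namespace Literature.MathematicalPhysics.QuantumFieldTheory

noncomputable section


/-! ## The change of variables `U ↦ Θ'U` for inserted partition functions -/

namespace InsertionSiteRP

open WilsonRP WilsonSiteRP

variable {d L N : ℕ} [NeZero d] [NeZero L] {G : Type*} [Group G] [TopologicalSpace G]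
  [IsTopologicalGroup G] [CompactSpace G] [MeasurableSpace G] [BorelSpace G]
  (ρ : G →* Matrix (Fin N) (Fin N) ℂ) (β : ℝ)

omit [MeasurableSpace G] [BorelSpace G] in
/-- **The reflected action is the action of the reflected insertion**: `S_u(Θ'U) = S_{uᶿ}(U)` for a central
insertion `u` (the reflection law `plaqReIns_negReflect` summed over the plaquettes, re-indexed by the
involution `ϑ'`). [cite: Kanazawa2008, §2 Lemma 2 eq. (15)] -/
theorem insertedWilsonAction_negReflect (hρ : Continuous ρ) {u : Plaquette d L → G}
    (hu : ∀ p, u p ∈ Subgroup.center G) (U : GaugeConfig d L G) :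
    insertedWilsonAction ρ u U.negReflect = insertedWilsonAction ρ (reflectInsertion u) U := by
  change ∑ p, ((N : ℝ) - plaqReIns ρ u U.negReflect p) = ∑ p, ((N : ℝ) - plaqReIns ρ (reflectInsertion u) U p)
  rw [Finset.sum_congr rfl fun p _ => by rw [plaqReIns_negReflect ρ hρ hu U p]]
  exact Equiv.sum_comp sitePlaqReflectEquiv (fun p => (N : ℝ) - plaqReIns ρ (reflectInsertion u) U p)

/-- ★ **`Z_{uᶿ} = Z_u`**: the inserted partition function is invariant under the reflection of the (central)
insertion — the change of variables `U ↦ Θ'U` preserves the product Haar measure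
(`measurePreserving_negReflect`). [cite: Kanazawa2008, §2 Lemma 2 eq. (15)] -/
theorem insertedPartitionFunction_reflectInsertion (hρ : Continuous ρ) {u : Plaquette d L → G}
    (hu : ∀ p, u p ∈ Subgroup.center G) :
    insertedPartitionFunction ρ β L (reflectInsertion u) = insertedPartitionFunction ρ β L u := by
  unfold insertedPartitionFunction
  have hmp := (measurePreserving_negReflect (d := d) (L := L) (G := G))
  have hg : AEStronglyMeasurable (fun U : GaugeConfig d L G => Real.exp (-(β * insertedWilsonAction ρ u U)))
      (Measure.map (GaugeConfig.negReflect : GaugeConfig d L G → GaugeConfig d L G)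
        (Measure.pi fun _ : Edge d L => haarProbability G)) :=
    (Real.measurable_exp.comp ((measurable_insertedWilsonAction ρ hρ u).const_mul β).neg).aestronglyMeasurable
  calc ∫ U : GaugeConfig d L G, Real.exp (-(β * insertedWilsonAction ρ (reflectInsertion u) U))
        ∂(Measure.pi fun _ : Edge d L => haarProbability G)
      = ∫ U : GaugeConfig d L G, Real.exp (-(β * insertedWilsonAction ρ u U.negReflect))
        ∂(Measure.pi fun _ : Edge d L => haarProbability G) := by
          simp_rw [insertedWilsonAction_negReflect ρ hρ hu]
    _ = ∫ U : GaugeConfig d L G, Real.exp (-(β * insertedWilsonAction ρ u U))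
        ∂(Measure.map (GaugeConfig.negReflect : GaugeConfig d L G → GaugeConfig d L G)
          (Measure.pi fun _ : Edge d L => haarProbability G)) :=
          (integral_map measurable_negReflect.aemeasurable hg).symm
    _ = _ := by rw [hmp.map_eq]

end InsertionSiteRP

/-! ## Axis-reversal covariance of the twisted partition function -/

namespace MultiTwist

open WilsonRP WilsonSiteRP InsertionSiteRP QuantumLattice

section General

variable {d L N : ℕ} [NeZero d] [NeZero L] {G : Type*} [Group G] [TopologicalSpace G]
  [IsTopologicalGroup G] [CompactSpace G] [MeasurableSpace G] [BorelSpace G]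
  (ρ : G →* Matrix (Fin N) (Fin N) ℂ) (β : ℝ)

omit [NeZero L] [TopologicalSpace G] [IsTopologicalGroup G] [CompactSpace G] [MeasurableSpace G]
  [BorelSpace G] in
/-- The reflection of the temporal stacks at time `-1` are the inverse stacks at time `0`
(from `reflectInsertion_temporalStacks_zero` and the involutivity of `ϑ'`). [cite: Kanazawa2008, §2 Lemma 2 eq. (15)] -/
theorem reflectInsertion_temporalStacks_neg_one (w : Fin d → G) (b : Fin d → ZMod L) :
    reflectInsertion (temporalStacks w (-1 : ZMod L) b) = temporalStacks (fun ν => (w ν)⁻¹) 0 b := by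
  have h := reflectInsertion_temporalStacks_zero (L := L) (fun ν => (w ν)⁻¹) b
  simp only [inv_inv] at h
  rw [← h, reflectInsertion_reflectInsertion]

/-- ★★ **Reversing the time axis does not change the twisted partition function**:
`Z(invertDir 0 z) = Z(z)` — 't Hooft's `W{-k, m} = W{k, m}` — for every twist `z` (any compact `G`,
continuous `ρ`, real `β`, `L ≥ 2`).  Proof: by the stack decomposition the insertion of `z` is the spatial
part times the temporal stacks `T(w)` at time `-1`; the change of variables `U ↦ Θ'U` (`Z_{uᶿ} = Z_u`) fixes
the spatial part and turns `T(w)` at time `-1` into `T(w⁻¹)` at time `0`, which the coboundary invariance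
moves back to time `-1`: that is the insertion of `invertDir 0 z`.
[cite: tHooft1979Flux, §6 first sentence and eq. (6.1)] [cite: Kanazawa2008, §2 Lemma 1 eq. (11), Lemma 2 eq. (15)] -/
theorem twistZ_invertDir_zero (hL : 1 < L) (hρ : Continuous ρ) (z : Twist d G) :
    TwistedSector.twistZ ρ (invertDir 0 z) β L = TwistedSector.twistZ ρ z β L := by
  haveI : Fact (1 < L) := ⟨hL⟩
  unfold TwistedSector.twistZ
  have hins : ∀ z' : Twist d G, (fun p : Plaquette d L => (plaquetteTwist z' p)⁻¹) = fun p =>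
      (plaquetteTwist (spatialPart z') p)⁻¹ *
        temporalStacks (temporalCornerValues z') (-1) (fun _ => -1) p := fun z' =>
    funext (plaquetteTwist_inv_eq_mul z')
  rw [hins, hins z, spatialPart_invertDir_zero, temporalCornerValues_invertDir_zero]
  -- move the stacks of the right-hand side from time `-1` to time `0`, then reflect
  rw [← insertedPartitionFunction_mul_temporalStacks_succ ρ β _ (temporalCornerValues_mem_center z)
    (-1) 0 (by ring) (fun _ => -1)]
  conv_rhs => rw [← insertedPartitionFunction_reflectInsertion ρ β hρ (fun p => Subgroup.mul_mem _
    (plaquetteTwist_inv_mem_center _ p) (temporalStacks_mem_center (temporalCornerValues_mem_center z) _ _ p))]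
  rw [reflectInsertion_mul (plaquetteTwist_inv_mem_center _), reflectInsertion_spatialPart,
    reflectInsertion_temporalStacks_zero,
    ← insertedPartitionFunction_mul_temporalStacks_succ ρ β _
      (fun ν => Subgroup.inv_mem _ (temporalCornerValues_mem_center z ν)) (-1) 0 (by ring) (fun _ => -1),
    insertedPartitionFunction_mul_temporalStacks_succ ρ β _
      (fun ν => Subgroup.inv_mem _ (temporalCornerValues_mem_center z ν)) (-1) 0 (by ring) (fun _ => -1)]

/-- ★★ **Reversing any axis does not change the twisted partition function**: `Z(invertDir μ z) = Z(z)`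
(transport to the time axis by the transposition `0 ↔ μ`, `twistZ_transposeTwist`). Together with the
transposition covariance this is the invariance of `W` under the full symmetry group of the symmetric
lattice torus fixing the origin ('t Hooft §6: «W will be invariant under joint rotations of `a_μ` and
`n_{μν}`»). [cite: tHooft1979Flux, §6 first sentence and eq. (6.1)] -/
theorem twistZ_invertDir (hL : 1 < L) (hρ : Continuous ρ) (μ : Fin d) (z : Twist d G) :
    TwistedSector.twistZ ρ (invertDir μ z) β L = TwistedSector.twistZ ρ z β L := by
  rw [← transposeTwist_invertDir_zero_transposeTwist μ z, twistZ_transposeTwist ρ β hρ,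
    twistZ_invertDir_zero ρ β hL hρ, twistZ_transposeTwist ρ β hρ]

/-- `Z(z⁻¹ on the planes through μ, ν; z elsewhere)`: reversing two axes. [cite: tHooft1979Flux, §6 eq. (6.1)] -/
theorem twistZ_invertDir_invertDir (hL : 1 < L) (hρ : Continuous ρ) (μ ν : Fin d) (z : Twist d G) :
    TwistedSector.twistZ ρ (invertDir μ (invertDir ν z)) β L = TwistedSector.twistZ ρ z β L := by
  rw [twistZ_invertDir ρ β hL hρ, twistZ_invertDir ρ β hL hρ]

omit [NeZero L] [TopologicalSpace G] [IsTopologicalGroup G] [CompactSpace G] [MeasurableSpace G]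
  [BorelSpace G] in
/-- A purely temporal twist is inverted by the reversal of the time axis. [cite: tHooft1979Flux, §6 eq. (6.1)] -/
theorem invertDir_zero_of_spatialPart_eq_one {z : Twist d G} (hz : spatialPart z = 1) :
    invertDir 0 z = z⁻¹ := by
  funext q
  by_cases hq : q.1.1 = 0
  · exact invertDir_of_mem 0 z (Or.inl hq)
  · have h := congrFun hz q
    rw [spatialPart_of_ne_zero z hq] at h
    rw [invertDir_of_not_mem 0 z (fun h' => h'.elim hq (plane_snd_ne_zero q)), Pi.inv_apply, h, Pi.one_apply,
      inv_one]

end General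

/-! ## The `SU(N)` tensor form and the reality of (5.4) -/

section SUN

variable {N n : ℕ} [NeZero N]

/-- Reversing the axis `μ` changes the sign of the components `n_{κλ}` with `μ ∈ {κ, λ}` of an `SU(N)` twist
tensor. [cite: tHooft1979Flux, §6 eq. (6.1)] -/
theorem invertDir_twistOfTensor (μ : Fin (n + 1)) (nT : QuantumLattice.Plane (n + 1) → ZMod N) :
    invertDir μ (twistOfTensor N nT) =
      twistOfTensor N (fun q => if q.1.1 = μ ∨ q.1.2 = μ then -nT q else nT q) := by
  funext q
  rw [invertDir_apply]
  by_cases hq : q.1.1 = μ ∨ q.1.2 = μ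
  · rw [if_pos hq]
    have h := congrFun (twistOfTensor_neg (fun q' => if q'.1.1 = μ ∨ q'.1.2 = μ then nT q' else 0)) q
    rw [Pi.inv_apply] at h
    change suCenter N (-(if q.1.1 = μ ∨ q.1.2 = μ then nT q else 0)) =
      (suCenter N (if q.1.1 = μ ∨ q.1.2 = μ then nT q else 0))⁻¹ at h
    rw [if_pos hq] at h
    change (suCenter N (nT q))⁻¹ = suCenter N (if q.1.1 = μ ∨ q.1.2 = μ then -nT q else nT q)
    rw [if_pos hq, h]
  · rw [if_neg hq]
    change suCenter N (nT q) = suCenter N (if q.1.1 = μ ∨ q.1.2 = μ then -nT q else nT q)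
    rw [if_neg hq]

/-- **`SU(N)`: reversing an axis does not change `W{n}`** (the components through the axis change sign).
[cite: tHooft1979Flux, §6 first sentence and eq. (6.1)] -/
theorem sun_twistZ_invertDir {L : ℕ} [NeZero L] (hL : 1 < L) (β : ℝ) (μ : Fin (n + 1))
    (nT : QuantumLattice.Plane (n + 1) → ZMod N) :
    TwistedSector.twistZ (fundamentalRep (Fin N))
        (twistOfTensor N (fun q => if q.1.1 = μ ∨ q.1.2 = μ then -nT q else nT q)) β L =
      TwistedSector.twistZ (fundamentalRep (Fin N)) (twistOfTensor N nT) β L := by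
  rw [← invertDir_twistOfTensor, twistZ_invertDir _ β hL (continuous_fundamentalRep (Fin N))]

omit [NeZero N] in
/-- `temporalTensor (-k) = -temporalTensor k`. [cite: tHooft1979Flux, §5 eq. (5.4)] -/
theorem temporalTensor_neg (k : Fin n → ZMod N) :
    THooftFlux.temporalTensor (-k) = -THooftFlux.temporalTensor k := by
  have h0 := THooftFlux.temporalTensor_add k (-k)
  rw [add_neg_cancel, THooftFlux.temporalTensor_zero] at h0
  exact (neg_eq_of_add_eq_zero_right h0.symm).symm

/-- Reversing the time axis of `m + temporalTensor k`, `m` purely magnetic, gives `m + temporalTensor (-k)`.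
[cite: tHooft1979Flux, §5 eq. (5.4) and §6 eq. (6.1)] -/
theorem invertDir_zero_twistOfTensor_add_temporalTensor {m : QuantumLattice.Plane (n + 1) → ZMod N}
    (hm : ∀ q : QuantumLattice.Plane (n + 1), q.1.1 = 0 → m q = 0) (k : Fin n → ZMod N) :
    invertDir 0 (twistOfTensor N (m + THooftFlux.temporalTensor k)) =
      twistOfTensor N (m + THooftFlux.temporalTensor (-k)) := by
  have hsp : spatialPart (twistOfTensor N (THooftFlux.temporalTensor k)) = 1 := by
    have h := spatialPart_twistOfTensor_add_temporalTensor (N := N) (0 : QuantumLattice.Plane (n + 1) → ZMod N) k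
    rw [zero_add, twistOfTensor_zero, spatialPart_one] at h
    exact h
  rw [twistOfTensor_add, twistOfTensor_add, invertDir_mul, ← spatialPart_twistOfTensor_of_magnetic hm,
    invertDir_zero_spatialPart, spatialPart_twistOfTensor_of_magnetic hm,
    invertDir_zero_of_spatialPart_eq_one hsp, temporalTensor_neg, twistOfTensor_neg]

/-- ★★ **`W{m, -k} = W{m, k}`**: the twisted partition function of `SU(N)` at a purely magnetic base tensor
`m` is an even function of the temporal twist `k` (reversal of the time axis), `L ≥ 2`, every `β`.
[cite: tHooft1979Flux, §5 eq. (5.4) and §6 first sentence] -/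
theorem sun_twistZ_temporal_neg {L : ℕ} [NeZero L] (hL : 1 < L) (β : ℝ)
    {m : QuantumLattice.Plane (n + 1) → ZMod N} (hm : ∀ q : QuantumLattice.Plane (n + 1), q.1.1 = 0 → m q = 0)
    (k : Fin n → ZMod N) :
    TwistedSector.twistZ (fundamentalRep (Fin N)) (twistOfTensor N (m + THooftFlux.temporalTensor (-k))) β L =
      TwistedSector.twistZ (fundamentalRep (Fin N)) (twistOfTensor N (m + THooftFlux.temporalTensor k)) β L := by
  rw [← invertDir_zero_twistOfTensor_add_temporalTensor hm k,
    twistZ_invertDir_zero _ β hL (continuous_fundamentalRep (Fin N))]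

/-- `conj e^{-2πi(k·e)/N} = e^{-2πi((-k)·e)/N}`. [cite: tHooft1979Flux, §5 eq. (5.4)] -/
theorem conj_fluxCharacter (e k : Fin n → ZMod N) :
    conj (THooftFlux.fluxCharacter e k) = THooftFlux.fluxCharacter e (-k) := by
  have h := conj_fluxCharacter_mul e k 0
  rwa [THooftFlux.fluxCharacter_zero_right, mul_one, zero_sub] at h

/-- ★★ **'t Hooft's electric-flux weights (5.4) are real** for every purely magnetic `m`, every `β`, every
`L ≥ 2` and every flux vector `e`: `conj w(e, m) = w(e, m)` by the `k ↦ -k` symmetry of `W{m + k}` (reversal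
of the time axis) and `conj χ_e(k) = χ_e(-k)`. [cite: tHooft1979Flux, §5 eq. (5.4) and §6 first sentence] -/
theorem conj_electricFluxWeight {L : ℕ} [NeZero L] (hL : 1 < L) (β : ℝ)
    {m : QuantumLattice.Plane (n + 1) → ZMod N} (hm : ∀ q : QuantumLattice.Plane (n + 1), q.1.1 = 0 → m q = 0)
    (e : Fin n → ZMod N) :
    conj (THooftFlux.electricFluxWeight N L β m e) = THooftFlux.electricFluxWeight N L β m e := by
  rw [THooftFlux.electricFluxWeight_def, map_mul, map_sum]
  have hN : conj (((N : ℂ) ^ n)⁻¹) = ((N : ℂ) ^ n)⁻¹ := by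
    rw [map_inv₀, map_pow, Complex.conj_natCast]
  rw [hN]
  congr 1
  calc ∑ k : Fin n → ZMod N, conj (THooftFlux.fluxCharacter e k *
        (TwistedSector.twistZ (fundamentalRep (Fin N)) (twistOfTensor N (m + THooftFlux.temporalTensor k)) β L : ℂ))
      = ∑ k : Fin n → ZMod N, THooftFlux.fluxCharacter e (-k) *
        (TwistedSector.twistZ (fundamentalRep (Fin N))
          (twistOfTensor N (m + THooftFlux.temporalTensor (-k))) β L : ℂ) :=
        Finset.sum_congr rfl fun k _ => by
          rw [map_mul, Complex.conj_ofReal, conj_fluxCharacter, sun_twistZ_temporal_neg hL β hm k]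
    _ = ∑ k : Fin n → ZMod N, THooftFlux.fluxCharacter e k *
        (TwistedSector.twistZ (fundamentalRep (Fin N)) (twistOfTensor N (m + THooftFlux.temporalTensor k)) β L : ℂ) :=
        Equiv.sum_comp (Equiv.neg (Fin n → ZMod N)) (fun k => THooftFlux.fluxCharacter e k *
          (TwistedSector.twistZ (fundamentalRep (Fin N))
            (twistOfTensor N (m + THooftFlux.temporalTensor k)) β L : ℂ))

/-- ★★ **`Im e^{-βF(e,m)} = 0`** (purely magnetic `m`, every `β`, `L ≥ 2`, every `e`).
[cite: tHooft1979Flux, §5 eq. (5.4) and §6 first sentence] -/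
theorem electricFluxWeight_im_eq_zero {L : ℕ} [NeZero L] (hL : 1 < L) (β : ℝ)
    {m : QuantumLattice.Plane (n + 1) → ZMod N} (hm : ∀ q : QuantumLattice.Plane (n + 1), q.1.1 = 0 → m q = 0)
    (e : Fin n → ZMod N) :
    (THooftFlux.electricFluxWeight N L β m e).im = 0 :=
  Complex.conj_eq_iff_im.1 (conj_electricFluxWeight hL β hm e)

end SUN

end MultiTwist

end

end Literature.MathematicalPhysics.QuantumFieldTheory
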